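import Literature.MathematicalPhysics.QuantumFieldTheory.Balaban1983to89.BalabanAdmissibleClassParams
import Literature.MathematicalPhysics.QuantumFieldTheory.Balaban1983to89.T4AveragingDisintegration
import Summits.QuantumFields.YangMills.Theorems.FluctuationComparisonRegPrIntLOrganTangentTelescopeWindowPath
import Summits.QuantumFields.YangMills.Theorems.FluctuationComparisonRegPrIntLOrganTangentSmallStepOneBond
import Summits.QuantumFields.YangMills.Theorems.FluctuationComparisonRegPrIntLOrganTangentWindowGaugeInvariance
import Summits.QuantumFields.YangMills.Theorems.FluctuationComparisonRegPrIntLOrganTangentFlatAnchorEven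
import Summits.QuantumFields.YangMills.Theorems.FluctuationComparisonRegPrIntLOrganTangentSmallStepChordPath
import Summits.QuantumFields.YangMills.Theorems.FluctuationComparisonRegPrIntLOrganTangentAnchorFreeOscillation
import Literature.MathematicalPhysics.QuantumFieldTheory.Balaban1983to89.B15SU2ChartHolomorphic
import Literature.MathematicalPhysics.QuantumFieldTheory.Balaban1983to89.T4CubeChartExp
import Literature.MathematicalPhysics.QuantumFieldTheory.Balaban1983to89.T4ExpWindowSmallField
import Literature.MathematicalPhysics.QuantumFieldTheory.Balaban1983to89.T4SmallFieldWindowSandwich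
import Literature.MathematicalPhysics.QuantumFieldTheory.Balaban1983to89.T3InteriorExcision
import Literature.MathematicalPhysics.QuantumFieldTheory.Balaban1983to89.T3ThresholdSmallness
import Literature.MathematicalPhysics.QuantumFieldTheory.Balaban1983to89.T3PrintedMinimiserExistence
import Literature.MathematicalPhysics.QuantumFieldTheory.Balaban1983to89.T3MinimiserStabilityReduction
import HarnessLib

/-!
# HOME SCRATCH (ideator ym-r3-idea-1 g27, v18 pen) — THE JUNCTION `directTransport_supR : O1ᵘ-H v2 → (P-b′) → S3ᴴ`, kernel-checked
# against the DRAFT texts of `V18_draft.lean` (restated here BY TEXT; (P-b′) = w4 g22 `exists_smallStep_chordPath_gaugeCopy` v1.1 as a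
# HYPOTHESIS until it lands; `GRAnchorFree` §1–§3 restated BY TEXT since Cruxes modules are not importable on the farm).
# v1.1 (226b7d47866d05c3): (P-b′) ✓p798086 BY NAME (§F).  v1.2 (this write): §B BY NAME (`import …OrganTangentAnchorFreeOscillation`, ✓p799177;
# ★★OWNER №282 (A) ∕ idea-crit-5 #615) · px19 g18's FIVE one-line `linarith only [...]` budget edits carried (LEAD w3 g24 №17: `hM0`, `hA1`, `hwY`,
# `haY`, `hYA` — statements untouched) · route-independent imports (px19 rehearsal v4: lit `BalabanAdmissibleClassParams` + `T4AveragingDisintegration`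
# replace `…BackwardLiouvilleRigidityOneStepBackwardContractionAdmDescentDisintegration`, so no Theses-cone dependency).  Texts == `V18DraftTexts` v0.3
# for `OneStepTransportUH` ∕ `BackwardStabilityFinSupH` (unchanged since v0.2; v0.3 only re-types S1aᴴ, which the junction does not mention).

Route: O1ᵘ-H (direct transport from the seed height `T` to `j`) gives the OUTPUT presentation `(c′, a′, w′, k′)` at `j` — a marginal of size
`a′` and an H-clause for `R_j := h_j − marginal(c′)` on the `θ_j∕4`-window with cap `r` and letters `k′ ≤ w′`; (P-b′) at path profile `b₀∕8`
joins `1` to a gauge copy `U^u` of every inner-window `U` by right exponential moves of size `≤ δ := σ·θ_j∕4` with volume-uniform per-bond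
count, prefixes in `θ_j∕8`, excitations in `θ_j∕8 + 4·dist1 ≤ θ_j∕4`; `R_j` is gauge invariant (✓p794698), so `R_j U = R_j (U^u)` and
TN-OSC's `osc_flat_window_path_le` (anchor letters from the clause itself, TN-ANCHOR-FREE) bounds `|R_j U − R_j 1| ≤ 1.5·w′·(nσ)²`,
`nσ ≤ 10·#PBond_j∕√θ_j`; the marginal contributes `≤ 2a′·β_j·#Plaq_j`; `a′ + θ·w′∕(β_jθ_j²) ≤ Y := (Ctr + Σεd + C·w₀)·x_T + δ_j`.
HONEST: bookkeeping over hypotheses; nothing of Bałaban's asserted; O1ᵘ-H∕(P-b′ until landed)∕S1aᴴ are HYPOTHESES; O1∕O1ᵘ-H∕S3ᴴ∕crux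
20520∕`YM3TorusSU2` NOT proved; registry v11.4 №36 + `Lines/runpair_organ.lean` v17.2 untouched; R3 = SU(2) YM₃ on T³ at fixed lattice
data — NOT d = 4, NOT infinite volume, NOT a mass gap, NOT Clay; no summit is proved by a junction file.
-/

set_option autoImplicit false

noncomputable section

open MeasureTheory Filter Topology Function
open Literature.MathematicalPhysics.QuantumFieldTheory.Balaban1983to89 T3ContinuumYM3Torus T3NestedUnitLaws
  T3UnitLawDensityEML T4Continuum BalabanUVClass T3UnitScaleTilt
open T4CubeChartGnomonic (SU2)
open T4HaarSU2ExpChart (expPoint)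
open T4CubeChartExp (expPt toE)
open B15SU2ChartHolomorphic (expPointC coe_expPoint_eq_expPointC)
open Summit.QuantumFields.YangMills.Theorems.OrganTangentTelescopeWindowPath (firstDiff_step_on clause_update_of_HClauseSq)
open Summit.QuantumFields.YangMills.Theorems.OrganTangentSmallStepOneBond (plaqDev_update_le)
open scoped BigOperators

namespace Summit.QuantumFields.YangMills.Cruxes.FluctuationComparisonRegPrIntL.JunctionDraft

/-! ## §A The v18 draft texts (BY TEXT from `V18_draft.lean`) and (P-b′)'s statement -/

/-- sfCut, R-CUT-χ token of record (byte-identical with runpair_organ v17.2 :166). -/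
noncomputable def sfCut {P : Params} {k : ℕ} (θ : ℝ) (U : GaugeField P k ↥(Matrix.specialUnitaryGroup (Fin 2) ℂ)) : ℝ :=
  ∏ p : Plaq P k, max 0 (min 1 ((24 / 25 * θ - dist1 (GaugeField.plaqHol U p)) / ((24 / 25 - 1 / 2) * θ)))

/-- `HClauseSq θ r k R` · THE SCALED ONE-BOND-PAIR CLAUSE (tree text: ✓p797413 `firstDiff_window_path`'s hypothesis `h`, byte-identical body). -/
def HClauseSq {P : Params} {j : ℕ} (θ r : ℝ) (k : PBond P j → PBond P j → ℝ)
    (R : GaugeField P j ↥(Matrix.specialUnitaryGroup (Fin 2) ℂ) → ℝ) : Prop :=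
  ∀ (b b' : PBond P j) (v v' : Fin 3 → ℝ) (U V W Z : GaugeField P j ↥(Matrix.specialUnitaryGroup (Fin 2) ℂ)),
    ‖v‖ ≤ r * θ → ‖v'‖ ≤ r * θ → PlaqSmall θ U → PlaqSmall θ V → PlaqSmall θ W → PlaqSmall θ Z →
    (∀ e, e ≠ b → V e = U e) → V b = U b * expPt v → (∀ e, e ≠ b' → W e = U e) → W b' = U b' * expPt v' →
    (∀ e, e ≠ b' → Z e = V e) → Z b' = V b' * expPt v' →
    |R Z - R V - R W + R U| ≤ k b b' * (‖v‖ / θ) * (‖v'‖ / θ)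

/-- `AnalyticPairWindowAt θ r B f` · THE ANALYTICITY PREDICATE (β) — LEAD spec §1 text VERBATIM ([Balaban1985UV3] p.263 (c)): an INTERFACE. -/
def AnalyticPairWindowAt {P : Params} {j : ℕ} (θ r B : ℝ) (f : GaugeField P j ↥(Matrix.specialUnitaryGroup (Fin 2) ℂ) → ℝ) : Prop :=
  ∀ (U : GaugeField P j ↥(Matrix.specialUnitaryGroup (Fin 2) ℂ)), PlaqSmall θ U →
    ∀ (b b' : PBond P j) (v v' : Fin 3 → ℝ), ‖v‖ ≤ 1 → ‖v'‖ ≤ 1 →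
      ∃ g : ℂ × ℂ → ℂ, DifferentiableOn ℂ g (Metric.ball (0 : ℂ) (r * θ) ×ˢ Metric.ball (0 : ℂ) (r * θ)) ∧
        (∀ (s t : ℝ) (V Z : GaugeField P j ↥(Matrix.specialUnitaryGroup (Fin 2) ℂ)), |s| < r * θ → |t| < r * θ →
          (∀ e, e ≠ b → V e = U e) → V b = U b * expPt (s • v) → (∀ e, e ≠ b' → Z e = V e) → Z b' = V b' * expPt (t • v') →
          g ((s : ℂ), (t : ℂ)) = ((f Z : ℝ) : ℂ)) ∧
        ∀ z ∈ Metric.ball (0 : ℂ) (r * θ) ×ˢ Metric.ball (0 : ℂ) (r * θ), ‖g z - g 0‖ ≤ B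

/-- O1ᵘ-H v2 · UNIFORM MULTI-STEP (DIRECT) TRANSPORT in the Hessian currency (see the module doc for the four conventions). XL; NOT PRINTED as a
theorem — [Balaban1985UV3] p.263 (c) + [Balaban1988RG2] (0.3)–(0.12) give the analyticity∕localisation it would be assembled from. -/
def OneStepTransportUH : Prop :=
  ∃ γ₁ : ℝ, 0 < γ₁ ∧ ∀ (F : T3Family) (γ : ℝ), 0 < γ → γ ≤ γ₁ →
  ∀ (b₀ p₀ : ℝ) (j₀ : ℕ) (prm : ℕ → ClassParams) (η : ℕ → ℝ) (rA : ℝ) (Bρ : ℕ → ℝ), 0 < b₀ → 0 < p₀ → AdmissibleClassParams F γ b₀ p₀ prm →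
  (∀ j, 0 ≤ η j) → Summable η → Summable (fun i => ∑' k, η (k + i)) →
  Tendsto (fun j => (∑' k, η (k + j)) * ((1 + 2 * ((F.L : ℝ) ^ j / γ) * (Fintype.card (Plaq (F.P j) 0) : ℝ)) * (Fintype.card (PBond (F.P j) 0) : ℝ) ^ 2)) atTop (𝓝 0) →
  0 < rA →
  ∃ κ₀ : ℝ, 0 < κ₀ ∧ ∀ (κ : ℝ), 0 < κ → κ ≤ κ₀ →
  ∃ (θ r Ctr C w₀ : ℝ) (εd δ : ℕ → ℝ) (j₁ : ℕ), 0 < θ ∧ 0 < r ∧ 1 ≤ Ctr ∧ 0 ≤ C ∧ 0 < w₀ ∧ (∀ j, 0 ≤ εd j ∧ 0 ≤ δ j) ∧ Summable εd ∧ Summable δ ∧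
  Summable (fun i => ∑' k, δ (k + i)) ∧
  Tendsto (fun j => (∑' k, δ (k + j)) * ((1 + 2 * ((F.L : ℝ) ^ j / γ) * (Fintype.card (Plaq (F.P j) 0) : ℝ)) * (Fintype.card (PBond (F.P j) 0) : ℝ) ^ 2)) atTop (𝓝 0) ∧
  j₀ ≤ j₁ ∧
  ∀ (ν : ℕ → (j : ℕ) → MeasureTheory.Measure (GaugeField (F.P j) 0 ↥(Matrix.specialUnitaryGroup (Fin 2) ℂ))),
  (∀ K, ν K K = T4GenFunBounds.gibbsMeasure (F.P K) ((F.scheme ℰp γ).β K)) →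
  (∀ K j, j < K → ν K j = Measure.map (descend F ℰp j) (ν K (j + 1))) →
  ∀ (K K' : ℕ), K ≤ K' → ∀ (Ts T : ℕ), Ts < T → T ≤ K →
  ∀ (μ μ' : ((j : ℕ) → MeasureTheory.Measure (GaugeField (F.P j) 0 ↥(Matrix.specialUnitaryGroup (Fin 2) ℂ))))
    (ρ ρ' : ((j : ℕ) → GaugeField (F.P j) 0 ↥(Matrix.specialUnitaryGroup (Fin 2) ℂ) → ℝ)),
  (∀ j : ℕ, Ts ≤ j → j ≤ T → μ j = ν K j ∧ μ' j = ν K' j) →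
  (∀ j : ℕ, j < Ts → μ j = Measure.map (descend F ℰp j) ((μ (j + 1)).withDensity (fun U => ENNReal.ofReal (sfCut (θBal F.L γ b₀ p₀ (j + 1)) U))) ∧
    μ' j = Measure.map (descend F ℰp j) ((μ' (j + 1)).withDensity (fun U => ENNReal.ofReal (sfCut (θBal F.L γ b₀ p₀ (j + 1)) U)))) →
  (∀ j : ℕ, Ts ≤ j → j < T → μ j = Measure.map (descend F ℰp j) (μ (j + 1)) ∧ μ' j = Measure.map (descend F ℰp j) (μ' (j + 1))) →
  (∀ j : ℕ, j ≤ T → IsFiniteMeasure (μ j) ∧ IsFiniteMeasure (μ' j)) →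
  (∀ j : ℕ, j₀ ≤ j → j ≤ T → ((∀ U, PlaqSmall (θBal F.L γ b₀ p₀ j) U → 0 < ρ j U ∧ 0 < ρ' j U) ∧
    μ j = (fieldMeasure _ _ _).withDensity (fun U => ENNReal.ofReal (ρ j U)) ∧ μ' j = (fieldMeasure _ _ _).withDensity (fun U => ENNReal.ofReal (ρ' j U)) ∧
    (∃ κ : ℝ, MemAtHeight F ℰp j (prm j) (fun U => Real.exp κ * ρ j U)) ∧ (∃ κ : ℝ, MemAtHeight F ℰp j (prm j) (fun U => Real.exp κ * ρ' j U)) ∧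
    μ j {U | ¬ PlaqSmall (θBal F.L γ b₀ p₀ j) U} ≤ ENNReal.ofReal (η j) ∧ μ' j {U | ¬ PlaqSmall (θBal F.L γ b₀ p₀ j) U} ≤ ENNReal.ofReal (η j) ∧
    (ContinuousOn (ρ j) {U | PlaqSmall (θBal F.L γ b₀ p₀ j) U} ∧ ContinuousOn (ρ' j) {U | PlaqSmall (θBal F.L γ b₀ p₀ j) U}) ∧
    (AnalyticPairWindowAt (θBal F.L γ b₀ p₀ j / 2) rA (Bρ j) (fun U => Real.log (ρ j U)) ∧
      AnalyticPairWindowAt (θBal F.L γ b₀ p₀ j / 2) rA (Bρ j) (fun U => Real.log (ρ' j U))))) →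
  ∀ (w : ℝ), 0 ≤ w → w / (((F.L : ℝ) ^ Ts / γ) * θBal F.L γ b₀ p₀ Ts ^ 2) ≤ w₀ →
  (∃ k : PBond (F.P Ts) 0 → PBond (F.P Ts) 0 → ℝ, (∀ b b', 0 ≤ k b b') ∧
    (∀ b, ∑ b', k b b' * Real.exp (κ * (b.src.tdist b'.src : ℝ)) ≤ w) ∧
    HClauseSq (θBal F.L γ b₀ p₀ Ts / 4) (rA / 2) k (fun U => Real.log (ρ Ts U) - Real.log (ρ' Ts U))) →
  ∀ (j : ℕ), j₁ ≤ j → j + 1 ≤ Ts →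
  ∃ (c' : Plaq (F.P j) 0 → ℝ) (a' w' : ℝ), 0 ≤ a' ∧ 0 ≤ w' ∧
    a' + θ * (w' / (((F.L : ℝ) ^ j / γ) * θBal F.L γ b₀ p₀ j ^ 2)) ≤
      (Ctr + εd (T - (Ts + 1)) + C * (w / (((F.L : ℝ) ^ Ts / γ) * θBal F.L γ b₀ p₀ Ts ^ 2))) *
        (w / (((F.L : ℝ) ^ Ts / γ) * θBal F.L γ b₀ p₀ Ts ^ 2)) + δ j ∧
    (∀ p, |c' p| ≤ a') ∧
    ∃ k' : PBond (F.P j) 0 → PBond (F.P j) 0 → ℝ, (∀ b b', 0 ≤ k' b b') ∧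
      (∀ b, ∑ b', k' b b' * Real.exp (κ * (b.src.tdist b'.src : ℝ)) ≤ w') ∧
      HClauseSq (θBal F.L γ b₀ p₀ j / 4) r k'
        (fun U => Real.log (ρ j U) - Real.log (ρ' j U) - ((F.L : ℝ) ^ j / γ) * ∑ p, c' p * (1 - reTr (GaugeField.plaqHol U p)))

/-- S3ᴴ · BACKWARD STABILITY ON FINITE RUNS, H-CURRENCY, SUP-OSCILLATION FORM (TN-OSC): S3 v17.2's frame with (β) in block ⑧, the H-seed at
`T`, and the conclusion = the inner-window sup-oscillation of `h_j` relative to `1` at path profile `b₀∕8`, RHS `(Cs·x_T + δ j)·β_j·(2·#Plaq_j + #PBond_j²)` (v0.2: (P-b′) v1.1's θ-free count kills the `1∕θ_j`).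
DERIVED (junction `directTransport_supR : OneStepTransportUH → BackwardStabilityFinSupH` over P-b′ + brick T + GRAnchorFree). NOT PRINTED. XL. -/
def BackwardStabilityFinSupH : Prop :=
  ∃ pW : ℝ, ∃ γ₁ : ℝ, 0 < γ₁ ∧ ∀ (F : T3Family) (γ : ℝ), 0 < γ → γ ≤ γ₁ →
  ∀ (b₀ p₀ κ : ℝ) (j₀ : ℕ) (prm : ℕ → ClassParams) (η : ℕ → ℝ) (rA : ℝ) (Bρ : ℕ → ℝ), 0 < b₀ → 0 < p₀ → pW ≤ p₀ → AdmissibleClassParams F γ b₀ p₀ prm → 0 < κ →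
  (∀ j, 0 ≤ η j) → Summable η → Summable (fun i => ∑' k, η (k + i)) →
  Tendsto (fun j => (∑' k, η (k + j)) * ((1 + 2 * ((F.L : ℝ) ^ j / γ) * (Fintype.card (Plaq (F.P j) 0) : ℝ)) * (Fintype.card (PBond (F.P j) 0) : ℝ) ^ 2)) atTop (𝓝 0) →
  0 < rA →
  ∃ (Cs w₀ : ℝ) (δ : ℕ → ℝ) (j₁ : ℕ), 0 ≤ Cs ∧ 0 < w₀ ∧ (∀ j, 0 ≤ δ j) ∧ Summable δ ∧ Summable (fun i => ∑' k, δ (k + i)) ∧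
  Tendsto (fun j => (∑' k, δ (k + j)) * ((1 + 2 * ((F.L : ℝ) ^ j / γ) * (Fintype.card (Plaq (F.P j) 0) : ℝ)) * (Fintype.card (PBond (F.P j) 0) : ℝ) ^ 2)) atTop (𝓝 0) ∧
  j₀ ≤ j₁ ∧
  ∀ (ν : ℕ → (j : ℕ) → MeasureTheory.Measure (GaugeField (F.P j) 0 ↥(Matrix.specialUnitaryGroup (Fin 2) ℂ))),
  (∀ K, ν K K = T4GenFunBounds.gibbsMeasure (F.P K) ((F.scheme ℰp γ).β K)) →
  (∀ K j, j < K → ν K j = Measure.map (descend F ℰp j) (ν K (j + 1))) →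
  ∀ (K K' : ℕ), K ≤ K' → ∀ (T Tt : ℕ), T < Tt → Tt ≤ K →
  ∀ (μ μ' : ((j : ℕ) → MeasureTheory.Measure (GaugeField (F.P j) 0 ↥(Matrix.specialUnitaryGroup (Fin 2) ℂ))))
    (ρ ρ' : ((j : ℕ) → GaugeField (F.P j) 0 ↥(Matrix.specialUnitaryGroup (Fin 2) ℂ) → ℝ)),
  (∀ j : ℕ, T ≤ j → j ≤ Tt → μ j = ν K j ∧ μ' j = ν K' j) →
  (∀ j : ℕ, j < T → μ j = Measure.map (descend F ℰp j) ((μ (j + 1)).withDensity (fun U => ENNReal.ofReal (sfCut (θBal F.L γ b₀ p₀ (j + 1)) U))) ∧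
    μ' j = Measure.map (descend F ℰp j) ((μ' (j + 1)).withDensity (fun U => ENNReal.ofReal (sfCut (θBal F.L γ b₀ p₀ (j + 1)) U)))) →
  (∀ j : ℕ, T ≤ j → j < Tt → μ j = Measure.map (descend F ℰp j) (μ (j + 1)) ∧ μ' j = Measure.map (descend F ℰp j) (μ' (j + 1))) →
  (∀ j : ℕ, j ≤ Tt → IsFiniteMeasure (μ j) ∧ IsFiniteMeasure (μ' j)) →
  (∀ j : ℕ, j₀ ≤ j → j ≤ Tt → ((∀ U, PlaqSmall (θBal F.L γ b₀ p₀ j) U → 0 < ρ j U ∧ 0 < ρ' j U) ∧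
    μ j = (fieldMeasure _ _ _).withDensity (fun U => ENNReal.ofReal (ρ j U)) ∧ μ' j = (fieldMeasure _ _ _).withDensity (fun U => ENNReal.ofReal (ρ' j U)) ∧
    (∃ κ : ℝ, MemAtHeight F ℰp j (prm j) (fun U => Real.exp κ * ρ j U)) ∧ (∃ κ : ℝ, MemAtHeight F ℰp j (prm j) (fun U => Real.exp κ * ρ' j U)) ∧
    μ j {U | ¬ PlaqSmall (θBal F.L γ b₀ p₀ j) U} ≤ ENNReal.ofReal (η j) ∧ μ' j {U | ¬ PlaqSmall (θBal F.L γ b₀ p₀ j) U} ≤ ENNReal.ofReal (η j) ∧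
    (ContinuousOn (ρ j) {U | PlaqSmall (θBal F.L γ b₀ p₀ j) U} ∧ ContinuousOn (ρ' j) {U | PlaqSmall (θBal F.L γ b₀ p₀ j) U}) ∧
    (AnalyticPairWindowAt (θBal F.L γ b₀ p₀ j / 2) rA (Bρ j) (fun U => Real.log (ρ j U)) ∧
      AnalyticPairWindowAt (θBal F.L γ b₀ p₀ j / 2) rA (Bρ j) (fun U => Real.log (ρ' j U))))) →
  ∀ (wT : ℝ), 0 ≤ wT → wT / (((F.L : ℝ) ^ T / γ) * θBal F.L γ b₀ p₀ T ^ 2) ≤ w₀ →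
  (∃ kT : PBond (F.P T) 0 → PBond (F.P T) 0 → ℝ, (∀ b b', 0 ≤ kT b b') ∧
    (∀ b, ∑ b', kT b b' * Real.exp (κ * (b.src.tdist b'.src : ℝ)) ≤ wT) ∧
    HClauseSq (θBal F.L γ b₀ p₀ T / 4) (rA / 2) kT (fun U => Real.log (ρ T U) - Real.log (ρ' T U))) →
  ∀ (j : ℕ), j₁ ≤ j → j ≤ T →
  ∀ U : GaugeField (F.P j) 0 ↥(Matrix.specialUnitaryGroup (Fin 2) ℂ), PlaqSmall (θBal F.L γ (Real.sqrt (b₀ / 8)) (p₀ / 2) j) U →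
    |(Real.log (ρ j U) - Real.log (ρ' j U)) - (Real.log (ρ j 1) - Real.log (ρ' j 1))| ≤
      (Cs * (wT / (((F.L : ℝ) ^ T / γ) * θBal F.L γ b₀ p₀ T ^ 2)) + δ j) *
        (((F.L : ℝ) ^ j / γ) * (2 * (Fintype.card (Plaq (F.P j) 0) : ℝ) + (Fintype.card (PBond (F.P j) 0) : ℝ) ^ 2))


/-- (P-b′) w4 g22 `…OrganTangentSmallStepChordPath.exists_smallStep_chordPath_gaugeCopy` v1.1 (SIGNATURE eef18f76 → v11), BY TEXT. -/
def SmallStepChordPath : Prop :=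
    ∃ pW : ℝ, ∀ (p₀ : ℝ), pW ≤ p₀ → ∀ (F : T3Family) (γ b₀ : ℝ), 0 < γ → γ ≤ 1 → 0 < b₀ → ∃ jW : ℕ, ∀ j : ℕ, jW ≤ j →
      ∀ U : GaugeField (F.P j) 0 ↥(Matrix.specialUnitaryGroup (Fin 2) ℂ), PlaqSmall (θBal F.L γ (Real.sqrt b₀) (p₀ / 2) j) U →
        ∀ δ : ℝ, 0 < δ → ∀ [DecidableEq (PBond (F.P j) 0)],
          ∃ (u : GaugeTransf (F.P j) 0 ↥(Matrix.specialUnitaryGroup (Fin 2) ℂ)) (path : List (PBond (F.P j) 0 × (Fin 3 → ℝ))),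
            (∀ q ∈ path, ‖q.2‖ ≤ δ) ∧
            (∀ b : PBond (F.P j) 0, path.countP (fun q => decide (q.1 = b)) ≤
              ⌈1 / (Real.sqrt (θBal F.L γ b₀ p₀ j) / 16)⌉₊ *
                (⌈Real.pi / 2 * (3 * (Real.sqrt (θBal F.L γ b₀ p₀ j) / 16) ^ 2 / 2) / δ⌉₊ + 2)) ∧
            List.foldl (fun (W : GaugeField (F.P j) 0 ↥(Matrix.specialUnitaryGroup (Fin 2) ℂ)) (q : PBond (F.P j) 0 × (Fin 3 → ℝ)) =>
                update W q.1 (W q.1 * expPt q.2)) 1 path = GaugeField.gaugeAct u U ∧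
            (∀ m : ℕ, m ≤ path.length → PlaqSmall (θBal F.L γ b₀ p₀ j)
              (List.foldl (fun (W : GaugeField (F.P j) 0 ↥(Matrix.specialUnitaryGroup (Fin 2) ℂ)) (q : PBond (F.P j) 0 × (Fin 3 → ℝ)) =>
                update W q.1 (W q.1 * expPt q.2)) 1 (path.take m))) ∧
            ∀ m : ℕ, m ≤ path.length → ∀ (b : PBond (F.P j) 0) (w : Fin 3 → ℝ),
              PlaqSmall (θBal F.L γ b₀ p₀ j + 4 * dist1 (expPt w))
                (update (List.foldl (fun (W : GaugeField (F.P j) 0 ↥(Matrix.specialUnitaryGroup (Fin 2) ℂ)) (q : PBond (F.P j) 0 × (Fin 3 → ℝ)) =>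
                  update W q.1 (W q.1 * expPt q.2)) 1 (path.take m)) b
                  ((List.foldl (fun (W : GaugeField (F.P j) 0 ↥(Matrix.specialUnitaryGroup (Fin 2) ℂ)) (q : PBond (F.P j) 0 × (Fin 3 → ℝ)) =>
                    update W q.1 (W q.1 * expPt q.2)) 1 (path.take m)) b * expPt w))

/-! ## §B TN-ANCHOR-FREE + TN-OSC — BY NAME (v1.2): ✓p799177 px19 g18 `Theorems/…OrganTangentAnchorFreeOscillation.lean` (ns
`…Theorems.OrganTangentAnchorFreeOscillation`, tree sha16 a71a3b7e3ece5dcd; 13∕13 theorem names + signatures == crux workfile `GRAnchorFree.lean`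
61fb5a2234d356d0 — idea-crit-5 #615).  v1.1 carried these 239 lines BY TEXT; ★★OWNER №282 (A) ∕ critic #615: switch to the import at this write. -/

open Summit.QuantumFields.YangMills.Theorems.OrganTangentAnchorFreeOscillation

/-! ## §C Small helpers -/

section Helpers

variable {α β : Type*} [Fintype α] [DecidableEq α]

/-- `∑_b #{steps at b} = #steps`. -/
theorem sum_countP_fst_eq_length (l : List (α × β)) :
    ∑ b, l.countP (fun q => decide (q.1 = b)) = l.length := by
  induction l with
  | nil => simp
  | cons a l ih =>
    simp only [List.countP_cons, List.length_cons, Finset.sum_add_distrib, ih]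
    have : ∑ b : α, (if decide (a.1 = b) = true then 1 else 0) = 1 := by
      simp [Finset.sum_ite_eq]
    omega

end Helpers

/-- `dist1 (expPt v) ≤ √3·‖v‖` (sup-norm coordinates). -/
theorem dist1_expPt_le_sqrt3_mul_norm (v : Fin 3 → ℝ) : dist1 (expPt v) ≤ Real.sqrt 3 * ‖v‖ :=
  T4ExpWindowSmallField.dist1_expPt_le_of_mem_cube (T4CubePoincare.mem_cube_iff.2 fun i => by
    rw [← Real.norm_eq_abs]; exact norm_le_pi_norm v i)

/-- A row-mass bound dominates every letter: `0 ≤ k`, `κ ≥ 0` ⇒ `k b b′ ≤ ∑_{b″} k b b″·e^{κ d} ≤ w`. -/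
theorem letter_le_rowMass {P : Params} {j : ℕ} {k : PBond P j → PBond P j → ℝ} {κ w : ℝ} (hκ : 0 ≤ κ)
    (hk : ∀ b b', 0 ≤ k b b') (hrow : ∀ b, ∑ b', k b b' * Real.exp (κ * (b.src.tdist b'.src : ℝ)) ≤ w) (b b' : PBond P j) :
    k b b' ≤ w := by
  have h1 : k b b' ≤ k b b' * Real.exp (κ * (b.src.tdist b'.src : ℝ)) :=
    le_mul_of_one_le_right (hk b b') (Real.one_le_exp (mul_nonneg hκ (Nat.cast_nonneg _)))
  have h2 : k b b' * Real.exp (κ * (b.src.tdist b'.src : ℝ)) ≤ ∑ b'', k b b'' * Real.exp (κ * (b.src.tdist b''.src : ℝ)) :=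
    Finset.single_le_sum (f := fun b'' => k b b'' * Real.exp (κ * (b.src.tdist b''.src : ℝ)))
      (fun b'' _ => mul_nonneg (hk b b'') (Real.exp_nonneg _)) (Finset.mem_univ b')
  exact h1.trans (h2.trans (hrow b))

/-- Row-mass bounds are monotone in the rate: `κ′ ≤ κ` ⇒ `∑ k·e^{κ′d} ≤ ∑ k·e^{κd} ≤ w`. -/
theorem rowMass_mono {P : Params} {j : ℕ} {k : PBond P j → PBond P j → ℝ} {κ κ' w : ℝ} (hκ : κ' ≤ κ)
    (hk : ∀ b b', 0 ≤ k b b') (hrow : ∀ b, ∑ b', k b b' * Real.exp (κ * (b.src.tdist b'.src : ℝ)) ≤ w) (b : PBond P j) :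
    ∑ b', k b b' * Real.exp (κ' * (b.src.tdist b'.src : ℝ)) ≤ w := by
  refine (Finset.sum_le_sum fun b' _ => ?_).trans (hrow b)
  exact mul_le_mul_of_nonneg_left (Real.exp_le_exp.2 (mul_le_mul_of_nonneg_right hκ (Nat.cast_nonneg _))) (hk b b')

/-- `θBal` is linear in `b₀`: the path profile `b₀∕8`. -/
theorem θBal_div8 (L : ℕ) (γ b₀ p₀ : ℝ) (i : ℕ) : θBal L γ (b₀ / 8) p₀ i = θBal L γ b₀ p₀ i / 8 := by
  rw [show b₀ / 8 = (1 / 8) * b₀ by ring, T3InteriorExcision.θBal_mul]; ring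


/-! ## §D The per-height core: OUTPUT clause + gauge invariance + (P-b′)'s chord path ⇒ sup-oscillation of the clause's `R` -/

section Core

open Summit.QuantumFields.YangMills.Theorems.OrganTangentFlatAnchorEven (flatBond_apply_inv_eq)

/-- Count arithmetic: (P-b′) v1.1's per-bond multiplicity at path profile `θ∕8` with step `δ := σ·θ∕4`, times `σ`, is `≤ 10∕√θ`
(`θ ≤ 1`, `σ ≤ 1∕16`, `π ≤ 4`). -/
theorem count_mul_sigma_le {θ σ : ℝ} (hθ : 0 < θ) (hθ1 : θ ≤ 1) (hσ : 0 < σ) (hσ1 : σ ≤ 1 / 16) :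
    ((⌈1 / (Real.sqrt (θ / 8) / 16)⌉₊ *
        (⌈Real.pi / 2 * (3 * (Real.sqrt (θ / 8) / 16) ^ 2 / 2) / (σ * (θ / 4))⌉₊ + 2) : ℕ) : ℝ) * σ ≤ 10 / Real.sqrt θ := by
  have hs0 : 0 < Real.sqrt (θ / 8) := Real.sqrt_pos.2 (by positivity)
  have hs2 : Real.sqrt (θ / 8) ^ 2 = θ / 8 := Real.sq_sqrt (by positivity)
  have ht0 : 0 < Real.sqrt θ := Real.sqrt_pos.2 hθ
  have ht1 : Real.sqrt θ ≤ 1 := Real.sqrt_le_one.mpr hθ1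
  have h3s : Real.sqrt θ ≤ 3 * Real.sqrt (θ / 8) := by
    have h := Real.sqrt_le_sqrt (show θ ≤ 9 * (θ / 8) by linarith)
    rwa [Real.sqrt_mul (by norm_num : (0:ℝ) ≤ 9), show Real.sqrt 9 = 3 by
      rw [show (9:ℝ) = 3 ^ 2 by norm_num, Real.sqrt_sq (by norm_num : (0:ℝ) ≤ 3)]] at h
  -- first factor `⌈16∕s⌉₊ ≤ 49∕√θ`
  have hA : (⌈1 / (Real.sqrt (θ / 8) / 16)⌉₊ : ℝ) ≤ 49 / Real.sqrt θ := by
    have hx : 0 ≤ 1 / (Real.sqrt (θ / 8) / 16) := by positivity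
    have h1 := Nat.ceil_lt_add_one hx
    have h2 : 1 / (Real.sqrt (θ / 8) / 16) ≤ 48 / Real.sqrt θ := by
      rw [div_div_eq_mul_div, one_mul, div_le_div_iff₀ hs0 ht0]
      nlinarith [h3s]
    have h3 : (1:ℝ) ≤ 1 / Real.sqrt θ := by rw [le_div_iff₀ ht0]; linarith
    calc (⌈1 / (Real.sqrt (θ / 8) / 16)⌉₊ : ℝ) ≤ 1 / (Real.sqrt (θ / 8) / 16) + 1 := h1.le
      _ ≤ 48 / Real.sqrt θ + 1 / Real.sqrt θ := add_le_add h2 h3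
      _ = 49 / Real.sqrt θ := by ring
  -- second factor times `σ`: `(⌈3π∕(2048σ)⌉₊ + 2)·σ ≤ 1∕5`
  have hq : Real.pi / 2 * (3 * (Real.sqrt (θ / 8) / 16) ^ 2 / 2) / (σ * (θ / 4)) = 3 * Real.pi / (2048 * σ) := by
    rw [div_pow, hs2]; field_simp; ring
  have hB : ((⌈Real.pi / 2 * (3 * (Real.sqrt (θ / 8) / 16) ^ 2 / 2) / (σ * (θ / 4))⌉₊ : ℝ) + 2) * σ ≤ 1 / 5 := by
    rw [hq]
    have hx : 0 ≤ 3 * Real.pi / (2048 * σ) := by positivity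
    have h1 := Nat.ceil_lt_add_one hx
    have hpi := Real.pi_le_four
    calc ((⌈3 * Real.pi / (2048 * σ)⌉₊ : ℝ) + 2) * σ ≤ (3 * Real.pi / (2048 * σ) + 1 + 2) * σ := by
          apply mul_le_mul_of_nonneg_right _ hσ.le; linarith
      _ = 3 * Real.pi / 2048 + 3 * σ := by field_simp; ring
      _ ≤ 1 / 5 := by nlinarith
  push_cast
  calc (⌈1 / (Real.sqrt (θ / 8) / 16)⌉₊ : ℝ) *
        ((⌈Real.pi / 2 * (3 * (Real.sqrt (θ / 8) / 16) ^ 2 / 2) / (σ * (θ / 4))⌉₊ : ℝ) + 2) * σ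
      = (⌈1 / (Real.sqrt (θ / 8) / 16)⌉₊ : ℝ) *
        (((⌈Real.pi / 2 * (3 * (Real.sqrt (θ / 8) / 16) ^ 2 / 2) / (σ * (θ / 4))⌉₊ : ℝ) + 2) * σ) := by ring
    _ ≤ 49 / Real.sqrt θ * (1 / 5) := mul_le_mul hA hB (by positivity) (by positivity)
    _ ≤ 10 / Real.sqrt θ := by rw [div_mul_div_comm, div_le_div_iff₀ (by positivity) ht0]; nlinarith

variable {F : T3Family} {γ b₀ p₀ : ℝ} {j : ℕ}

/-- ★ THE PER-HEIGHT CORE.  An H-clause for a gauge-invariant `R` on the `θ_j∕4`-window with cap `rr` and letters `k ≤ K`, and (P-b′)'s chord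
path at profile `b₀∕8` with step `σ·θ_j∕4` (`σ ≤ rr`, `σ ≤ 1∕16`, `θ_j ≤ 1`) from `1` to a gauge copy of `U`, give
`|R U − R 1| ≤ 150·K·#PBond_j²∕θ_j` (TN-ANCHOR-FREE + TN-OSC: `osc_flat_window_path_le`, `n·σ ≤ 10·#PBond_j∕√θ_j`). [bookkeeping] -/
theorem supOsc_core [DecidableEq (PBond (F.P j) 0)]
    (hθ : 0 < θBal F.L γ b₀ p₀ j) (hθ1 : θBal F.L γ b₀ p₀ j ≤ 1)
    {rr K σ : ℝ} (hK : 0 ≤ K) (hσ : 0 < σ) (hσr : σ ≤ rr) (hσ1 : σ ≤ 1 / 16)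
    {k : PBond (F.P j) 0 → PBond (F.P j) 0 → ℝ} {R : GaugeField (F.P j) 0 SU2 → ℝ}
    (hk : ∀ b b', 0 ≤ k b b' ∧ k b b' ≤ K)
    (hcl : HClauseSq (θBal F.L γ b₀ p₀ j / 4) rr k R) (hinv : GaugeField.GaugeInvariant R)
    (U : GaugeField (F.P j) 0 SU2) (u : GaugeTransf (F.P j) 0 SU2) (path : List (PBond (F.P j) 0 × (Fin 3 → ℝ)))
    (hsz : ∀ q ∈ path, ‖q.2‖ ≤ σ * (θBal F.L γ b₀ p₀ j / 4))
    (hcount : ∀ b : PBond (F.P j) 0, path.countP (fun q => decide (q.1 = b)) ≤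
      ⌈1 / (Real.sqrt (θBal F.L γ (b₀ / 8) p₀ j) / 16)⌉₊ *
        (⌈Real.pi / 2 * (3 * (Real.sqrt (θBal F.L γ (b₀ / 8) p₀ j) / 16) ^ 2 / 2) / (σ * (θBal F.L γ b₀ p₀ j / 4))⌉₊ + 2))
    (hend : List.foldl (fun (W : GaugeField (F.P j) 0 SU2) (q : PBond (F.P j) 0 × (Fin 3 → ℝ)) => update W q.1 (W q.1 * expPt q.2)) 1 path =
      GaugeField.gaugeAct u U)
    (hpre : ∀ m : ℕ, m ≤ path.length → PlaqSmall (θBal F.L γ (b₀ / 8) p₀ j)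
      (List.foldl (fun (W : GaugeField (F.P j) 0 SU2) (q : PBond (F.P j) 0 × (Fin 3 → ℝ)) => update W q.1 (W q.1 * expPt q.2)) 1 (path.take m)))
    (hexc : ∀ m : ℕ, m ≤ path.length → ∀ (b : PBond (F.P j) 0) (w : Fin 3 → ℝ),
      PlaqSmall (θBal F.L γ (b₀ / 8) p₀ j + 4 * dist1 (expPt w))
        (update (List.foldl (fun (W : GaugeField (F.P j) 0 SU2) (q : PBond (F.P j) 0 × (Fin 3 → ℝ)) => update W q.1 (W q.1 * expPt q.2)) 1 (path.take m)) b
          ((List.foldl (fun (W : GaugeField (F.P j) 0 SU2) (q : PBond (F.P j) 0 × (Fin 3 → ℝ)) => update W q.1 (W q.1 * expPt q.2)) 1 (path.take m)) b *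
            expPt w))) :
    |R U - R 1| ≤ 150 * K * (Fintype.card (PBond (F.P j) 0) : ℝ) ^ 2 / θBal F.L γ b₀ p₀ j := by
  have h8 : θBal F.L γ (b₀ / 8) p₀ j = θBal F.L γ b₀ p₀ j / 8 := θBal_div8 F.L γ b₀ p₀ j
  rw [h8] at hcount hpre hexc
  set θj := θBal F.L γ b₀ p₀ j with hθj
  have hθW : 0 < θj / 4 := by positivity
  -- `R U = R (U^u) = R (end of the path)`
  have hRU : R U = R (List.foldl (fun (W : GaugeField (F.P j) 0 SU2) (q : PBond (F.P j) 0 × (Fin 3 → ℝ)) =>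
      update W q.1 (W q.1 * expPt q.2)) 1 path) := by rw [hend, hinv u U]
  have hinv' : ∀ (b : PBond (F.P j) 0) (g : SU2), R (update 1 b g⁻¹) = R (update 1 b g) := fun b g => flatBond_apply_inv_eq hinv b g
  have hk' : ∀ p ∈ path, ∀ q ∈ path, 0 ≤ k p.1 q.1 ∧ k p.1 q.1 ≤ K := fun p _ q _ => hk p.1 q.1
  have hsz' : ∀ q ∈ path, ‖q.2‖ / (θj / 4) ≤ σ := fun q hq => by rw [div_le_iff₀ hθW]; exact hsz q hq
  have hs3 : Real.sqrt 3 ≤ 2 := by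
    rw [show (2:ℝ) = Real.sqrt 4 by rw [show (4:ℝ) = 2 ^ 2 by norm_num, Real.sqrt_sq (by norm_num : (0:ℝ) ≤ 2)]]
    exact Real.sqrt_le_sqrt (by norm_num)
  have hd3 : ∀ q ∈ path, 4 * dist1 (expPt q.2) ≤ θj / 8 := by
    intro q hq
    have h3 : dist1 (expPt q.2) ≤ 2 * (σ * (θj / 4)) :=
      (dist1_expPt_le_sqrt3_mul_norm q.2).trans (mul_le_mul hs3 (hsz q hq) (norm_nonneg _) (by norm_num))
    nlinarith [hσ1, hθ]
  have hdist : ∀ q ∈ path, dist1 (expPt q.2) < θj / 4 := fun q hq => by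
    have := hd3 q hq; nlinarith [GaugeGroup.dist1_nonneg (expPt q.2), hθ]
  have hgood : ∀ n ≤ path.length,
      PlaqSmall (θj / 4) ((path.take n).foldl (fun U p => update U p.1 (U p.1 * expPt p.2)) (1 : GaugeField (F.P j) 0 SU2)) ∧
      ∀ q ∈ path, PlaqSmall (θj / 4) (update ((path.take n).foldl (fun U p => update U p.1 (U p.1 * expPt p.2)) (1 : GaugeField (F.P j) 0 SU2)) q.1
        (((path.take n).foldl (fun U p => update U p.1 (U p.1 * expPt p.2)) (1 : GaugeField (F.P j) 0 SU2)) q.1 * expPt q.2)) := by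
    intro n hn
    exact ⟨T3PrintedMinimiserExistence.plaqSmall_of_le (by linarith) (hpre n hn),
      fun q hq => T3PrintedMinimiserExistence.plaqSmall_of_le (by linarith [hd3 q hq]) (hexc n hn q.1 q.2)⟩
  have hosc := osc_flat_window_path_le hθW hcl hinv' hK hσ.le hσr path hk' hsz' hdist hgood
  -- length: `n ≤ #PBond·N`, `N·σ ≤ 10∕√θ_j`
  set n := path.length with hn
  have hlen : (n : ℝ) * σ ≤ (Fintype.card (PBond (F.P j) 0) : ℝ) * (10 / Real.sqrt θj) := by
    have hsum := sum_countP_fst_eq_length path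
    have h1 : n ≤ Fintype.card (PBond (F.P j) 0) * (⌈1 / (Real.sqrt (θj / 8) / 16)⌉₊ *
        (⌈Real.pi / 2 * (3 * (Real.sqrt (θj / 8) / 16) ^ 2 / 2) / (σ * (θj / 4))⌉₊ + 2)) := by
      rw [hn, ← hsum]
      calc ∑ b, path.countP (fun q => decide (q.1 = b))
          ≤ ∑ _b : PBond (F.P j) 0, ⌈1 / (Real.sqrt (θj / 8) / 16)⌉₊ *
              (⌈Real.pi / 2 * (3 * (Real.sqrt (θj / 8) / 16) ^ 2 / 2) / (σ * (θj / 4))⌉₊ + 2) := Finset.sum_le_sum fun b _ => hcount b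
        _ = _ := by rw [Finset.sum_const, smul_eq_mul, Finset.card_univ]
    have h2 := count_mul_sigma_le hθ hθ1 hσ hσ1
    calc (n : ℝ) * σ ≤ ((Fintype.card (PBond (F.P j) 0) * (⌈1 / (Real.sqrt (θj / 8) / 16)⌉₊ *
        (⌈Real.pi / 2 * (3 * (Real.sqrt (θj / 8) / 16) ^ 2 / 2) / (σ * (θj / 4))⌉₊ + 2)) : ℕ) : ℝ) * σ :=
          mul_le_mul_of_nonneg_right (by exact_mod_cast h1) hσ.le
      _ = (Fintype.card (PBond (F.P j) 0) : ℝ) * (((⌈1 / (Real.sqrt (θj / 8) / 16)⌉₊ *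
        (⌈Real.pi / 2 * (3 * (Real.sqrt (θj / 8) / 16) ^ 2 / 2) / (σ * (θj / 4))⌉₊ + 2) : ℕ) : ℝ) * σ) := by push_cast; ring
      _ ≤ (Fintype.card (PBond (F.P j) 0) : ℝ) * (10 / Real.sqrt θj) := mul_le_mul_of_nonneg_left h2 (Nat.cast_nonneg _)
  have hsq : ((n : ℝ) * σ) ^ 2 ≤ (Fintype.card (PBond (F.P j) 0) : ℝ) ^ 2 * (100 / θj) := by
    have h0 : 0 ≤ (n : ℝ) * σ := by positivity
    calc ((n : ℝ) * σ) ^ 2 ≤ ((Fintype.card (PBond (F.P j) 0) : ℝ) * (10 / Real.sqrt θj)) ^ 2 := pow_le_pow_left₀ h0 hlen 2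
      _ = (Fintype.card (PBond (F.P j) 0) : ℝ) ^ 2 * (100 / θj) := by rw [mul_pow, div_pow, Real.sq_sqrt hθ.le]; norm_num
  rw [hRU]
  refine hosc.trans ?_
  rcases Nat.eq_zero_or_pos n with hn0 | hn1
  · rw [hn0]; simp only [Nat.cast_zero, zero_mul]; positivity
  · have hσn : σ ≤ (n : ℝ) * σ := le_mul_of_one_le_left hσ.le (by exact_mod_cast hn1)
    have hsplit : (n : ℝ) * (K * σ / 2 + (n : ℝ) * (K * σ)) * σ = K / 2 * (((n : ℝ) * σ) * σ) + K * ((n : ℝ) * σ) ^ 2 := by ring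
    rw [hsplit]
    have hKn : K / 2 * (((n : ℝ) * σ) * σ) ≤ K / 2 * ((n : ℝ) * σ) ^ 2 := by
      refine mul_le_mul_of_nonneg_left ?_ (by positivity)
      rw [sq]; exact mul_le_mul_of_nonneg_left hσn (by positivity)
    calc K / 2 * (((n : ℝ) * σ) * σ) + K * ((n : ℝ) * σ) ^ 2 ≤ K / 2 * ((n : ℝ) * σ) ^ 2 + K * ((n : ℝ) * σ) ^ 2 := add_le_add hKn le_rfl
      _ = 3 / 2 * K * ((n : ℝ) * σ) ^ 2 := by ring
      _ ≤ 3 / 2 * K * ((Fintype.card (PBond (F.P j) 0) : ℝ) ^ 2 * (100 / θj)) := mul_le_mul_of_nonneg_left hsq (by positivity)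
      _ = 150 * K * (Fintype.card (PBond (F.P j) 0) : ℝ) ^ 2 / θj := by ring

end Core

/-! ## §E The junction `directTransport_supR : O1ᵘ-H v2 → (P-b′) → S3ᴴ` -/

/-- Pure arithmetic of the `j < T` assembly. -/
theorem assemble_lt {θ M A xT δj Y a' w' βj θj NP NB core marg : ℝ}
    (hθ : 0 < θ) (hM : M = 150 / θ + 150) (hβj : 0 < βj) (hθj : 0 < θj) (hθj1 : θj ≤ 1) (hNP : 0 ≤ NP)
    (ha' : 0 ≤ a') (haY : a' ≤ Y) (hwY : θ * w' ≤ Y * (βj * θj ^ 2)) (hYA : Y ≤ A * xT + δj)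
    (hcore : core ≤ 150 * w' * NB ^ 2 / θj) (hmarg : marg ≤ βj * (2 * NP) * a') :
    core + marg ≤ (M * A * xT + M * δj) * (βj * (2 * NP + NB ^ 2)) := by
  have hY0 : 0 ≤ Y := ha'.trans haY
  have hMθ : 0 ≤ 150 / θ := by positivity
  have hM1 : 150 / θ ≤ M := by rw [hM]; linarith
  have hM2 : 1 ≤ M := by rw [hM]; linarith
  have hM0 : 0 ≤ M := zero_le_one.trans hM2
  have hw' : w' ≤ Y * (βj * θj ^ 2) / θ := by rw [le_div_iff₀ hθ]; linarith
  have h1 : core ≤ M * Y * (βj * NB ^ 2) := by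
    refine hcore.trans ?_
    have h2 : 150 * w' * NB ^ 2 / θj ≤ 150 * (Y * (βj * θj ^ 2) / θ) * NB ^ 2 / θj := by gcongr
    refine h2.trans ?_
    have e : 150 * (Y * (βj * θj ^ 2) / θ) * NB ^ 2 / θj = (150 / θ) * Y * (βj * NB ^ 2) * θj := by
      field_simp
    rw [e]
    have h3 : (150 / θ) * Y * (βj * NB ^ 2) * θj ≤ (150 / θ) * Y * (βj * NB ^ 2) * 1 :=
      mul_le_mul_of_nonneg_left hθj1 (by positivity)
    rw [mul_one] at h3
    exact h3.trans (mul_le_mul_of_nonneg_right (mul_le_mul_of_nonneg_right hM1 hY0) (by positivity))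
  have h2 : marg ≤ M * Y * (βj * (2 * NP)) := by
    refine hmarg.trans ?_
    have h3 : βj * (2 * NP) * a' ≤ βj * (2 * NP) * Y := mul_le_mul_of_nonneg_left haY (by positivity)
    refine h3.trans ?_
    rw [mul_comm (βj * (2 * NP)) Y, mul_assoc]
    exact le_mul_of_one_le_left (by positivity) hM2
  have h3 : M * Y * (βj * NB ^ 2) + M * Y * (βj * (2 * NP)) = M * Y * (βj * (2 * NP + NB ^ 2)) := by ring
  have h4 : M * Y * (βj * (2 * NP + NB ^ 2)) ≤ M * (A * xT + δj) * (βj * (2 * NP + NB ^ 2)) :=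
    mul_le_mul_of_nonneg_right (mul_le_mul_of_nonneg_left hYA hM0) (by positivity)
  calc core + marg ≤ M * Y * (βj * NB ^ 2) + M * Y * (βj * (2 * NP)) := add_le_add h1 h2
    _ = M * Y * (βj * (2 * NP + NB ^ 2)) := h3
    _ ≤ M * (A * xT + δj) * (βj * (2 * NP + NB ^ 2)) := h4
    _ = (M * A * xT + M * δj) * (βj * (2 * NP + NB ^ 2)) := by ring

/-- Pure arithmetic of the `j = T` assembly. -/
theorem assemble_eq {θ M A xT δj wT βj θj NP NB core : ℝ}
    (hθ : 0 < θ) (hM : M = 150 / θ + 150) (hA1 : 1 ≤ A) (hδ : 0 ≤ δj) (hxT : 0 ≤ xT) (hβj : 0 < βj) (hθj : 0 < θj)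
    (hθj1 : θj ≤ 1) (hNP : 0 ≤ NP) (hwx : wT = xT * (βj * θj ^ 2)) (hcore : core ≤ 150 * wT * NB ^ 2 / θj) :
    core ≤ (M * A * xT + M * δj) * (βj * (2 * NP + NB ^ 2)) := by
  have hMθ : 0 ≤ 150 / θ := by positivity
  have hM150 : 150 ≤ M := by rw [hM]; linarith
  have hM0 : 0 ≤ M := le_trans (by norm_num) hM150
  have hMA : 150 ≤ M * A := by nlinarith
  refine hcore.trans ?_
  have e : 150 * wT * NB ^ 2 / θj = 150 * xT * (βj * NB ^ 2) * θj := by rw [hwx]; field_simp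
  rw [e]
  have h1 : 150 * xT * (βj * NB ^ 2) * θj ≤ 150 * xT * (βj * NB ^ 2) * 1 := mul_le_mul_of_nonneg_left hθj1 (by positivity)
  rw [mul_one] at h1
  refine h1.trans ?_
  calc 150 * xT * (βj * NB ^ 2) ≤ (M * A) * xT * (βj * NB ^ 2) := by gcongr
    _ ≤ (M * A * xT + M * δj) * (βj * NB ^ 2) := by
        apply mul_le_mul_of_nonneg_right _ (by positivity); nlinarith
    _ ≤ (M * A * xT + M * δj) * (βj * (2 * NP + NB ^ 2)) := by
        apply mul_le_mul_of_nonneg_left _ (by positivity)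
        apply mul_le_mul_of_nonneg_left _ hβj.le
        nlinarith

/-- ★★ THE JUNCTION (v18 H-currency, TN-OSC edition): O1ᵘ-H v2's direct transport from the seed height `T` to every `j ∈ [j₁, T)` (and the
seed clause itself at `j = T`), the gauge invariance of the organ's remainder (✓p794698) and its flat inversion-evenness (✓p793256),
(P-b′)'s volume-uniform chord path inside the `θ_j∕8`-window, and TN-ANCHOR-FREE + TN-OSC give S3ᴴ with `Cs := (150∕θ + 150)·(Ctr + Σεd + C·w₀)`,
`δ′ := (150∕θ + 150)·δ`, `w₀ := w₀`, `j₁ := max j₁ (max jW jθ)`.  [bookkeeping over hypotheses; nothing of Bałaban's asserted] -/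
theorem directTransport_supR (hO : OneStepTransportUH) (hPb : SmallStepChordPath) : BackwardStabilityFinSupH := by
  classical
  obtain ⟨pW, hPW⟩ := hPb
  obtain ⟨γ₁, hγ₁, HO⟩ := hO
  refine ⟨pW, min γ₁ 1, lt_min hγ₁ one_pos, ?_⟩
  intro F γ hγ hγle b₀ p₀ κ j₀ prm η rA Bρ hb₀ hp₀ hpW hadm hκ hη0 hηs hηt hηT hrA
  have hγ₁' : γ ≤ γ₁ := hγle.trans (min_le_left _ _)
  have hγ1 : γ ≤ 1 := hγle.trans (min_le_right _ _)
  obtain ⟨κ₀, hκ₀, HO1⟩ := HO F γ hγ hγ₁' b₀ p₀ j₀ prm η rA Bρ hb₀ hp₀ hadm hη0 hηs hηt hηT hrA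
  have hκ'0 : 0 < min κ κ₀ := lt_min hκ hκ₀
  obtain ⟨θ, r, Ctr, C, w₀, εd, δ, j₁, hθ, hr, hCtr, hC, hw₀, hεδ, hεs, hδs, hδt, hδT, hj₀₁, HO2⟩ :=
    HO1 (min κ κ₀) hκ'0 (min_le_right _ _)
  -- (P-b′) at path profile `b₀∕8`
  obtain ⟨jW, HPb⟩ := hPW p₀ hpW F γ (b₀ / 8) hγ hγ1 (by positivity)
  -- `θ_j ≤ 1` eventually
  obtain ⟨jθ, hjθ⟩ : ∃ jθ : ℕ, ∀ j, jθ ≤ j → θBal F.L γ b₀ p₀ j ≤ 1 := by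
    have ht := T3ThresholdSmallness.tendsto_θBal_atTop F.hL.2 hγ b₀ p₀
    obtain ⟨jθ, hj⟩ := Filter.eventually_atTop.1 (ht.eventually (Iio_mem_nhds one_pos))
    exact ⟨jθ, fun j hj' => (Set.mem_Iio.1 (hj j hj')).le⟩
  -- constants
  have hεdE : ∀ i, εd i ≤ ∑' i, εd i := fun i => hεs.le_tsum i (fun k _ => (hεδ k).1)
  obtain ⟨M, hM⟩ : ∃ M : ℝ, M = 150 / θ + 150 := ⟨_, rfl⟩
  have hMθ : 0 ≤ 150 / θ := by positivity
  have hM0 : 0 ≤ M := by rw [hM]; linarith only [hMθ]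
  have hE0 : 0 ≤ ∑' i, εd i := tsum_nonneg fun i => (hεδ i).1
  have hCw : 0 ≤ C * w₀ := by positivity
  obtain ⟨A, hA⟩ : ∃ A : ℝ, A = Ctr + ∑' i, εd i + C * w₀ := ⟨_, rfl⟩
  have hA1 : 1 ≤ A := by rw [hA]; linarith only [hCtr, hE0, hCw]
  have hMA0 : 0 ≤ M * A := mul_nonneg hM0 (zero_le_one.trans hA1)
  have htails : Summable (fun i => ∑' k, M * δ (k + i)) := by
    simp_rw [tsum_mul_left]; exact hδt.mul_left M
  have htend : Tendsto (fun j => (∑' k, M * δ (k + j)) * ((1 + 2 * ((F.L : ℝ) ^ j / γ) * (Fintype.card (Plaq (F.P j) 0) : ℝ)) *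
      (Fintype.card (PBond (F.P j) 0) : ℝ) ^ 2)) atTop (𝓝 0) := by
    have hfun : (fun j => (∑' k, M * δ (k + j)) * ((1 + 2 * ((F.L : ℝ) ^ j / γ) * (Fintype.card (Plaq (F.P j) 0) : ℝ)) *
        (Fintype.card (PBond (F.P j) 0) : ℝ) ^ 2))
        = fun j => M * ((∑' k, δ (k + j)) * ((1 + 2 * ((F.L : ℝ) ^ j / γ) * (Fintype.card (Plaq (F.P j) 0) : ℝ)) *
          (Fintype.card (PBond (F.P j) 0) : ℝ) ^ 2)) := by
      funext j; rw [tsum_mul_left]; ring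
    rw [hfun]; simpa using hδT.const_mul M
  refine ⟨M * A, w₀, fun j => M * δ j, max j₁ (max jW jθ), hMA0, hw₀, fun j => mul_nonneg hM0 (hεδ j).2,
    hδs.mul_left M, htails, htend, hj₀₁.trans (le_max_left _ _), ?_⟩
  intro ν hν1 hν2 K K' hKK' T Tt hTTt hTtK μ μ' ρ ρ' hruns hcut hcons hfin h8 wT hwT hxT hseed j hj₁ hjT U hU
  have hj₁' : j₁ ≤ j := (le_max_left _ _).trans hj₁
  have hjW : jW ≤ j := ((le_max_left _ _).trans (le_max_right _ _)).trans hj₁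
  have hjθ' : jθ ≤ j := ((le_max_right _ _).trans (le_max_right _ _)).trans hj₁
  have hθj1 : θBal F.L γ b₀ p₀ j ≤ 1 := hjθ j hjθ'
  have hθj : 0 < θBal F.L γ b₀ p₀ j := T3MinimiserStabilityReduction.θBal_pos F.hL.2.le hγ hγ1 hb₀ p₀ j
  have hL0 : (0 : ℝ) < F.L := by exact_mod_cast (zero_lt_one.trans F.hL.2)
  have hβj0 : 0 < (F.L : ℝ) ^ j / γ := by positivity
  have hNP : (0 : ℝ) ≤ (Fintype.card (Plaq (F.P j) 0) : ℝ) := Nat.cast_nonneg _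
  -- block ⑧ at `j`: the regular-class memberships (for gauge invariance)
  have hjTt : j ≤ Tt := hjT.trans hTTt.le
  obtain ⟨-, -, -, h8ρ, h8ρ', -⟩ := h8 j (hj₀₁.trans hj₁') hjTt
  -- step size
  set σ : ℝ := min (min r (rA / 2)) (1 / 16) with hσ
  have hσ0 : 0 < σ := lt_min (lt_min hr (half_pos hrA)) (by norm_num)
  have hσr : σ ≤ r := (min_le_left _ _).trans (min_le_left _ _)
  have hσA : σ ≤ rA / 2 := (min_le_left _ _).trans (min_le_right _ _)
  have hσ1 : σ ≤ 1 / 16 := min_le_right _ _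
  -- (P-b′)'s path for `U`
  obtain ⟨u, path, hszP, hcountP, hendP, hpreP, hexcP⟩ := HPb j hjW U hU (σ * (θBal F.L γ b₀ p₀ j / 4)) (by positivity)
  rcases Nat.lt_or_ge j T with hjlt | hjge
  · /- `j < T`: O1ᵘ-H v2's direct transport from the seed -/
    obtain ⟨kT, hkT0, hkTrow, hkTcl⟩ := hseed
    have hseed' : ∃ k : PBond (F.P T) 0 → PBond (F.P T) 0 → ℝ, (∀ b b', 0 ≤ k b b') ∧
        (∀ b, ∑ b', k b b' * Real.exp (min κ κ₀ * (b.src.tdist b'.src : ℝ)) ≤ wT) ∧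
        HClauseSq (θBal F.L γ b₀ p₀ T / 4) (rA / 2) k (fun U => Real.log (ρ T U) - Real.log (ρ' T U)) :=
      ⟨kT, hkT0, fun b => rowMass_mono (min_le_left _ _) hkT0 hkTrow b, hkTcl⟩
    obtain ⟨c', a', w', ha', hw', hY, hc', k', hk'0, hk'row, hk'cl⟩ :=
      HO2 ν hν1 hν2 K K' hKK' T Tt hTTt hTtK μ μ' ρ ρ' hruns hcut hcons hfin h8 wT hwT hxT hseed' j hj₁' (by omega)
    have hkK : ∀ b b', 0 ≤ k' b b' ∧ k' b b' ≤ w' := fun b b' => ⟨hk'0 b b', letter_le_rowMass hκ'0.le hk'0 hk'row b b'⟩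
    have hinv : GaugeField.GaugeInvariant (fun U : GaugeField (F.P j) 0 SU2 =>
        Real.log (ρ j U) - Real.log (ρ' j U) - ((F.L : ℝ) ^ j / γ) * ∑ p, c' p * (1 - reTr (GaugeField.plaqHol U p))) :=
      Summit.QuantumFields.YangMills.Theorems.OrganTangentWindowGaugeInvariance.gaugeInvariant_organDiscrepancy F h8ρ h8ρ' _ c'
    have hcore := supOsc_core hθj hθj1 hw' hσ0 hσr hσ1 hkK hk'cl hinv U u path hszP hcountP hendP hpreP hexcP
    -- the marginal at `U` and at `1`
    have hmargU : |((F.L : ℝ) ^ j / γ) * ∑ p, c' p * (1 - reTr (GaugeField.plaqHol U p))| ≤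
        ((F.L : ℝ) ^ j / γ) * (2 * (Fintype.card (Plaq (F.P j) 0) : ℝ)) * a' := by
      rw [abs_mul, abs_of_pos hβj0, mul_assoc]
      refine mul_le_mul_of_nonneg_left ?_ hβj0.le
      calc |∑ p, c' p * (1 - reTr (GaugeField.plaqHol U p))| ≤ ∑ p, |c' p * (1 - reTr (GaugeField.plaqHol U p))| :=
            Finset.abs_sum_le_sum_abs _ _
        _ ≤ ∑ _p : Plaq (F.P j) 0, a' * 2 := Finset.sum_le_sum fun p _ => by
            rw [abs_mul]
            have h12 := RegularGaugeGroup.one_sub_reTr_mem_Icc (GaugeField.plaqHol U p)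
            exact mul_le_mul (hc' p) (abs_le.2 ⟨by linarith [h12.1], h12.2⟩) (abs_nonneg _) ((abs_nonneg _).trans (hc' p))
        _ = 2 * (Fintype.card (Plaq (F.P j) 0) : ℝ) * a' := by rw [Finset.sum_const, nsmul_eq_mul, Finset.card_univ]; ring
    have hmarg1 : (∑ p, c' p * (1 - reTr (GaugeField.plaqHol (1 : GaugeField (F.P j) 0 SU2) p))) = 0 := by
      simp [T4SmallFieldWindowSandwich.plaqHol_one, GaugeGroup.reTr_one]
    -- sizes from the output budget
    have hD : 0 < ((F.L : ℝ) ^ j / γ) * θBal F.L γ b₀ p₀ j ^ 2 := by positivity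
    have hwY : θ * w' ≤ ((Ctr + εd (Tt - (T + 1)) + C * (wT / (((F.L : ℝ) ^ T / γ) * θBal F.L γ b₀ p₀ T ^ 2))) *
        (wT / (((F.L : ℝ) ^ T / γ) * θBal F.L γ b₀ p₀ T ^ 2)) + δ j) * (((F.L : ℝ) ^ j / γ) * θBal F.L γ b₀ p₀ j ^ 2) := by
      have h1 : θ * (w' / (((F.L : ℝ) ^ j / γ) * θBal F.L γ b₀ p₀ j ^ 2)) ≤ _ := le_trans (by linarith only [ha']) hY
      rwa [mul_div_assoc', div_le_iff₀ hD] at h1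
    have haY : a' ≤ (Ctr + εd (Tt - (T + 1)) + C * (wT / (((F.L : ℝ) ^ T / γ) * θBal F.L γ b₀ p₀ T ^ 2))) *
        (wT / (((F.L : ℝ) ^ T / γ) * θBal F.L γ b₀ p₀ T ^ 2)) + δ j := by
      have : 0 ≤ θ * (w' / (((F.L : ℝ) ^ j / γ) * θBal F.L γ b₀ p₀ j ^ 2)) := by positivity
      linarith only [this, hY]
    have hYA : (Ctr + εd (Tt - (T + 1)) + C * (wT / (((F.L : ℝ) ^ T / γ) * θBal F.L γ b₀ p₀ T ^ 2))) *
        (wT / (((F.L : ℝ) ^ T / γ) * θBal F.L γ b₀ p₀ T ^ 2)) + δ j ≤ A * (wT / (((F.L : ℝ) ^ T / γ) * θBal F.L γ b₀ p₀ T ^ 2)) + δ j := by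
      have h1 : εd (Tt - (T + 1)) ≤ ∑' i, εd i := hεdE _
      have h2 : C * (wT / (((F.L : ℝ) ^ T / γ) * θBal F.L γ b₀ p₀ T ^ 2)) ≤ C * w₀ := mul_le_mul_of_nonneg_left hxT hC
      have h0 : 0 ≤ wT / (((F.L : ℝ) ^ T / γ) * θBal F.L γ b₀ p₀ T ^ 2) := by positivity
      have h3 : Ctr + εd (Tt - (T + 1)) + C * (wT / (((F.L : ℝ) ^ T / γ) * θBal F.L γ b₀ p₀ T ^ 2)) ≤ A := by
        rw [hA]; linarith only [h1, h2]
      exact add_le_add (mul_le_mul_of_nonneg_right h3 h0) le_rfl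
    -- conclude
    have hdec : (Real.log (ρ j U) - Real.log (ρ' j U)) - (Real.log (ρ j 1) - Real.log (ρ' j 1))
        = ((Real.log (ρ j U) - Real.log (ρ' j U) - ((F.L : ℝ) ^ j / γ) * ∑ p, c' p * (1 - reTr (GaugeField.plaqHol U p))) -
            (Real.log (ρ j 1) - Real.log (ρ' j 1) - ((F.L : ℝ) ^ j / γ) *
              ∑ p, c' p * (1 - reTr (GaugeField.plaqHol (1 : GaugeField (F.P j) 0 SU2) p)))) +
          ((F.L : ℝ) ^ j / γ) * ∑ p, c' p * (1 - reTr (GaugeField.plaqHol U p)) := by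
      rw [hmarg1]; ring
    rw [hdec]
    exact (abs_add_le _ _).trans (assemble_lt hθ hM hβj0 hθj hθj1 hNP ha' haY hwY hYA hcore hmargU)
  · /- `j = T`: the seed clause itself -/
    obtain rfl : j = T := le_antisymm hjT hjge
    obtain ⟨kT, hkT0, hkTrow, hkTcl⟩ := hseed
    have hkK : ∀ b b', 0 ≤ kT b b' ∧ kT b b' ≤ wT := fun b b' => ⟨hkT0 b b', letter_le_rowMass hκ.le hkT0 hkTrow b b'⟩
    have hinv : GaugeField.GaugeInvariant (fun U : GaugeField (F.P j) 0 SU2 => Real.log (ρ j U) - Real.log (ρ' j U)) :=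
      Summit.QuantumFields.YangMills.Theorems.OrganTangentWindowGaugeInvariance.gaugeInvariant_organLogRatio F h8ρ h8ρ'
    have hcore := supOsc_core hθj hθj1 hwT hσ0 hσA hσ1 hkK hkTcl hinv U u path hszP hcountP hendP hpreP hexcP
    have hpos : 0 < ((F.L : ℝ) ^ j / γ) * θBal F.L γ b₀ p₀ j ^ 2 := by positivity
    have hwx : wT = wT / (((F.L : ℝ) ^ j / γ) * θBal F.L γ b₀ p₀ j ^ 2) * (((F.L : ℝ) ^ j / γ) * θBal F.L γ b₀ p₀ j ^ 2) := by
      rw [div_mul_cancel₀ _ hpos.ne']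
    exact assemble_eq hθ hM hA1 (hεδ j).2 (by positivity) hβj0 hθj hθj1 hNP hwx hcore

/-! ## §F (v1.1) (P-b′) BY NAME — the hypothesis `SmallStepChordPath` is ✓ `OrganTangentSmallStepChordPath.exists_smallStep_chordPath_gaugeCopy`
(w4 g22, tree sha16 a71eeaf6fcbd4dbe), so the junction reads: O1ᵘ-H v2 ALONE ⟹ S3ᴴ. -/

/-- (P-b′) holds in the tree (w4 g22's `exists_smallStep_chordPath_gaugeCopy`, BY NAME). -/
theorem smallStepChordPath_holds : SmallStepChordPath :=
  Summit.QuantumFields.YangMills.Theorems.OrganTangentSmallStepChordPath.exists_smallStep_chordPath_gaugeCopy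

/-- ★ THE JUNCTION, final form: the H-currency direct-transport organ O1ᵘ-H v2 gives the derived finite-run organ S3ᴴ (sup-oscillation
on the inner window), kernel-checked, no `sorry`; O1ᵘ-H v2 itself is an O-class HYPOTHESIS (not proved here or anywhere in the tree). -/
theorem backwardStabilityFinSupH_of_oneStepTransportUH (hO : OneStepTransportUH) : BackwardStabilityFinSupH :=
  directTransport_supR hO smallStepChordPath_holds

end Summit.QuantumFields.YangMills.Cruxes.FluctuationComparisonRegPrIntL.JunctionDraft
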